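import Summits.QuantumFields.BalabanUV.Beta.GAN24.WardResidualRotatedVertexWeighted
import Summits.QuantumFields.BalabanUV.Beta.GAN24.CubicPushFaceCharge

/-!
# `BalabanUV.Beta.GAN24.WardResidualRotatedVertexTransported` — binder row G-an2-4 ∕ (CONV-C), CT-W route «WC-TL» → «QR-LL», located identity of record (S) (the OWNER
# gan24-p1 g26∕g27's R12∕R14): **THE TRANSPORTED (α)-LETTER — THE COARSE FIELD–FIELD CHARGE OF `G_{j+1} ∘ (α) ∘ G_{j+1}` PER SLOT, ITS ZEROTH SLOT-MOMENT (= 0)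
# AND ITS SLOT-DIPOLE (CLOSED, LABEL-FREE), AS TREE TERMS** — the literal E15∕E19 quantity `q(s_α(e))`, `s_α = −(cE·wE)•mmRead(G_{j+1} (α) G_{j+1})`, up to the scalar
# `−(cE·wE)` (road-P2 chair `b2b-balaban-gan24-p2`, gen 38, INTENT 6 = the «UNTRIED» instance of my HANDOFF, done)

NOT IN PRINT; OUR BOOKKEEPING ([folklore] composition BY NAME: p2 g35's `SandwichReadoutSiteDep.hasSum_sandwich_readout_coDressKBmAt`, leaf-02's
`CubicPushFaceCharge.sum_sum_face_kron`, leaf-06's `StepResolventLegCharges.hasSum_KInvStep_inr_inl ∕ _inl_inr` + `MultiplierZeroMass.hasSum_KInvStep_mm_left ∕ _right`, an2's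
`SecondOrderResponse.vertexFamily_dM ∕ biLoc_smul`, and INTENT 5 `WardResidualRotatedVertexWeighted` §3∕§5; 0 `def`, 0 cited fact, 0 `def … : Prop`, 0 sorry).
HONEST FRAMING (cell contract, verbatim): «discharging `BetaPertH` makes Bałaban's UV stability UNCONDITIONAL — a real constructive-QFT result; it is NOT the continuum
limit and NOT the Clay problem.»  HONEST DEPENDENCY (verbatim): «continuum YM on T⁴ ⇐ BetaPertH ∧ nine spine estimates (0/9 proved); BetaPertH ⇐ (D1) ∧ (D4) ∧ CAP+tail;
G-an2-4 gates asym, D1 and NE2/3/4.»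

WHAT (in-block root, `Lc ≥ 1`, every `j`, all `cE cVH cΛ`; `G_{j+1} = coDressKBmAt ρ Lc (KInvStep Lc (j+1))`, `σ_{j+1} := ((Lc^{j+2})^{d+2})⁻¹` = the Kronecker coarse-leg charge of
`KInvStep Lc (j+1)`, `(α)(ν,y′) = ½ • dM (conjV G_{j+1} X_y) Lc S_{j+1} M1_{j+1} ν y′`, face weight `ω_{αβ}(x,z) := 𝟙[x_α % Lc = Lc−1 ∧ z_β % Lc = Lc−1]`):
* §1 `biLoc_rotatedVertex_comb` ((α) is bi-localised at its slot), **`hasSum_prod_transported_rotatedVertex_comb`**: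
  `HasSum ((x′,z′) ↦ (G_{j+1} ∘ (α)(ν,y′) ∘ G_{j+1})(Lc•x′, Lc•z′)_{(inr α, inr β)}) (−Lc²·σ_{j+1}²·V^{face}_{αβ}(y′))`, `V^{face}` = INTENT 5's `V_Z` with `Z` = the `ω_{αβ}`-charges
  of `S_{j+1} κ u` ∕ `M1_{j+1} ρ′ w` in channel `(inl α, inl β)` — THE TRANSPORTED (α)-CHARGE PER SLOT IS A FACE-WEIGHTED `V_Z`.
* §2 **`hasSum_transported_totalCharge_comb`** — its ZEROTH slot-moment VANISHES (E15 (iii) `M0(α) = 3.2e-12`, now a theorem for the literal), and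
  **`hasSum_transported_slotMoment_comb`** — its slot-DIPOLE in closed label-free form `−Lc²σ²·(−¼)·[Σ_κ Σ_{v∈box} 𝔤^{FM}_{κν,λ}(v)·Z^{face}_S(κ,v) + Σ_ρ′ 𝔤^{MM}_{ρ′ν,λ}·Z^{face}_M(ρ′,0)]`
  (E15: NONZERO, cancelling against (γ)'s — the (γ) twin is leaf-06's `GaugeReadChargeDipole`; the cancellation is the (S)∕(INV) row, not here).
Asserts NO value of Bałaban's tables; discharges NOTHING of (S) ∕ (INV) ∕ (Q-R) ∕ (LT) ∕ (Q-L) ∕ (C) ∕ «T2Shape» ∕ «T2Drift» ∕ (hW, hWall); NEVER «G-an2-4 closed» as (CONV-C);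
NOT D1, NOT BetaPertH, NOT continuum, NOT Clay.  2026-08-22; no existing file touched.
-/

noncomputable section

open Finset
open scoped BigOperators
open Literature.MathematicalPhysics.QuantumFieldTheory
open Literature.MathematicalPhysics.QuantumFieldTheory.Balaban1983to89
open Literature.MathematicalPhysics.QuantumFieldTheory.Balaban1983to89.Beta
open B12Sec2to5 (l1)
open ExpKernelCalculus (Site MKer BiLoc Decays VertexFamily comp)
open AffineAveraging (box toSite)
open AveragingContours (blk)
open OneStepResolventKernel (Fib LocStencil)
open OneStepKernelFamily (KInvStep colH decays_KInvStep)
open BalabanStepJets (locStencil_mono)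
open SecondOrderResponse (colM dM vertexFamily_dM)
open Summit.QuantumFields.BalabanUV.Beta.BorderedHessian (diagK)
open Summit.QuantumFields.BalabanUV.Beta.ChartConjugation (conjV)
open Summit.QuantumFields.BalabanUV.Beta.AveragingWardRootedStencils (legInd)
open Summit.QuantumFields.BalabanUV.Beta.AxialDressingRooted (coDressKBmAt decays_coDressKBmAt_KInvStep)
open Summit.QuantumFields.BalabanUV.Beta.SpineRooted (SpureRecAt M1At locStencil_SpureRecAt vertexFamily_M1At)
open Summit.QuantumFields.BalabanUV.Beta.WardLocusResidualClass (abs_blockGen_le)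
open Summit.QuantumFields.BalabanUV.Beta.GAN24.WardResidualLabelSums (decays_conjV_diagK)
open Summit.QuantumFields.BalabanUV.Beta.GAN24.SandwichReadoutSiteDep (hasSum_sandwich_readout_coDressKBmAt)
open Summit.QuantumFields.BalabanUV.Beta.GAN24.StepResolventLegCharges (hasSum_KInvStep_inr_inl hasSum_KInvStep_inl_inr)
open Summit.QuantumFields.BalabanUV.Beta.GAN24.MultiplierZeroMass (hasSum_KInvStep_mm_left hasSum_KInvStep_mm_right)
open Summit.QuantumFields.BalabanUV.Beta.GAN24.CubicPushFaceCharge (sum_sum_face_kron)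
open Summit.QuantumFields.BalabanUV.Beta.GAN24.WardResidualRotatedVertexWeighted (hasSum_weighted_rotatedVertex_comb hasSum_totalCharge_weighted_comb
  hasSum_slotMoment_weighted_comb)

namespace Summit.QuantumFields.BalabanUV.Beta.GAN24.WardResidualRotatedVertexTransported

variable {d Lc : ℕ} [NeZero Lc]

/-! ## §1 The transported (α)-charge per slot is a face-weighted `V_Z` -/

/-- [folklore] **(α) IS BI-LOCALISED AT ITS SLOT** (`vertexFamily_dM` through the decaying commutator kernel at a common rate, `biLoc_smul`): a rate `m > 0` and a constant
exist with `BiLoc ((α)(ν,y′)) (Lc•y′) (Lc•y′) C m`. -/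
theorem biLoc_rotatedVertex_comb (hLc : 1 ≤ Lc) {r : Fin (d + 1) → ℕ} (hr : r ∈ box (d + 1) Lc) (cE cVH cΛ : ℝ) (j : ℕ)
    (y : Fin (d + 1) → ℤ) (ν : Fin (d + 1)) (y' : Fin (d + 1) → ℤ) :
    ∃ C m : ℝ, 0 < m ∧ BiLoc ((1 / 2 : ℝ) • dM (conjV (coDressKBmAt (toSite r) Lc (KInvStep (d := d) Lc (j + 1)))
        (diagK (((1 : ℝ) / 2) • ∑ v ∈ box (d + 1) Lc, legInd (toSite r) ((Lc : ℤ) • y + toSite v)))) Lc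
        (SpureRecAt d Lc (toSite r) cE cVH cΛ (j + 1)) (M1At d Lc (toSite r) cΛ (j + 1)) ν y') ((Lc : ℤ) • y') ((Lc : ℤ) • y') C m := by
  obtain ⟨δG, CG, hδG, hCG, hG⟩ := decays_coDressKBmAt_KInvStep (d := d) hr (j + 1)
  have hg : ∀ p c, |(((1 : ℝ) / 2) • ∑ v ∈ box (d + 1) Lc, legInd (toSite r) ((Lc : ℤ) • y + toSite v)) p c| ≤
      |((1 : ℝ) / 2)| * (box (d + 1) Lc).card := fun p c => abs_blockGen_le Lc (toSite r) _ y p c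
  have hK := decays_conjV_diagK hG hg
  obtain ⟨Cs, δs, hδs, hS⟩ := locStencil_SpureRecAt (d := d) (Lc := Lc) hLc hr cE cVH cΛ (j + 1)
  have hCs : 0 ≤ Cs := (hS 0 0).nonneg (Sum.inl 0)
  set m : ℝ := min δs δG with hm
  have hm0 : 0 < m := lt_min hδs hδG
  have hSm : LocStencil (SpureRecAt d Lc (toSite r) cE cVH cΛ (j + 1)) Cs m := locStencil_mono hS hCs (min_le_left _ _)
  have hM := vertexFamily_M1At (d := d) hLc hr cΛ (j + 1) hm0.le
  have hCK : 0 ≤ 2 * CG * (|((1 : ℝ) / 2)| * (box (d + 1) Lc).card) := by positivity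
  have hV := vertexFamily_dM (N := Lc) hK hCK hSm hM hm0 (min_le_right _ _) ν y'
  exact ⟨_, m / 2, half_pos hm0, SecondOrderResponse.biLoc_smul (1 / 2 : ℝ) hV⟩

/-- NOT IN PRINT; OUR BOOKKEEPING.  **THE TRANSPORTED (α)-CHARGE PER SLOT IS A FACE-WEIGHTED `V_Z`**: with `σ := ((Lc^{j+2})^{d+2})⁻¹` (the Kronecker coarse-leg charge of
`KInvStep Lc (j+1)`) and the exit-face weight `ω_{αβ}(x,z) = 𝟙[x_α % Lc = Lc−1 ∧ z_β % Lc = Lc−1]`, the coarse mm-entries of `G_{j+1} ∘ (α)(ν,y′) ∘ G_{j+1}` have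
`HasSum` over `(x′,z′)` equal to `−Lc²·σ²·V^{face}_{αβ}(y′)`, `V^{face}` = `WardResidualRotatedVertexWeighted.hasSum_weighted_rotatedVertex_comb`'s value at `ω = ω_{αβ}`, channel
`(inl α, inl β)`.  (p2 g35's sandwich read-out at `V := (α)(ν,y′)` + leaf-02's Kronecker fold + INTENT 5; `mmRead` then places this in the next level's ff slot.) -/
theorem hasSum_prod_transported_rotatedVertex_comb (hLc : 1 ≤ Lc) {r : Fin (d + 1) → ℕ} (hr : r ∈ box (d + 1) Lc) (cE cVH cΛ : ℝ) (j : ℕ)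
    (y : Fin (d + 1) → ℤ) (ν : Fin (d + 1)) (y' : Fin (d + 1) → ℤ) (α β : Fin (d + 1)) :
    HasSum (fun xz : Site (d + 1) × Site (d + 1) =>
        comp (comp (coDressKBmAt (toSite r) Lc (KInvStep (d := d) Lc (j + 1)))
          ((1 / 2 : ℝ) • dM (conjV (coDressKBmAt (toSite r) Lc (KInvStep (d := d) Lc (j + 1)))
            (diagK (((1 : ℝ) / 2) • ∑ v ∈ box (d + 1) Lc, legInd (toSite r) ((Lc : ℤ) • y + toSite v)))) Lc
            (SpureRecAt d Lc (toSite r) cE cVH cΛ (j + 1)) (M1At d Lc (toSite r) cΛ (j + 1)) ν y'))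
          (coDressKBmAt (toSite r) Lc (KInvStep (d := d) Lc (j + 1))) ((Lc : ℤ) • xz.1) ((Lc : ℤ) • xz.2) (Sum.inr α) (Sum.inr β))
      (-((Lc : ℝ) ^ 2 * (((((Lc ^ (j + 1 + 1) : ℕ) : ℝ)) ^ (d + 1 + 1))⁻¹) ^ 2 *
        ((1 / 2 : ℝ) *
          ((∑ κ : Fin (d + 1), ∑' u : Site (d + 1),
              colH (coDressKBmAt (toSite r) Lc (KInvStep (d := d) Lc (j + 1))) Lc ν y' κ u
                * ((if y' = y then (1 / 2 : ℝ) else 0) - (if blk Lc u = y then (1 / 2 : ℝ) else 0))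
                * ∑' xz : Site (d + 1) × Site (d + 1),
                    (if xz.1 α % (Lc : ℤ) = (Lc : ℤ) - 1 ∧ xz.2 β % (Lc : ℤ) = (Lc : ℤ) - 1 then (1 : ℝ) else 0)
                      * SpureRecAt d Lc (toSite r) cE cVH cΛ (j + 1) κ u xz.1 xz.2 (Sum.inl α) (Sum.inl β))
            + ∑ ρ' : Fin (d + 1), ∑' w : Site (d + 1),
              colM (coDressKBmAt (toSite r) Lc (KInvStep (d := d) Lc (j + 1))) Lc ν y' ρ' w
                * ((if y' = y then (1 / 2 : ℝ) else 0) - (if w = y then (1 / 2 : ℝ) else 0))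
                * ∑' xz : Site (d + 1) × Site (d + 1),
                    (if xz.1 α % (Lc : ℤ) = (Lc : ℤ) - 1 ∧ xz.2 β % (Lc : ℤ) = (Lc : ℤ) - 1 then (1 : ℝ) else 0)
                      * M1At d Lc (toSite r) cΛ (j + 1) ρ' w xz.1 xz.2 (Sum.inl α) (Sum.inl β))))) := by
  classical
  obtain ⟨δ, C, hδ, -, hK⟩ := decays_KInvStep (d := d) (Lc := Lc) (j + 1)
  obtain ⟨CV, m, hm, hV⟩ := biLoc_rotatedVertex_comb hLc hr cE cVH cΛ j y ν y'
  -- the sandwich read-out at V := (α)(ν,y′) with the Kronecker charges of `KInvStep Lc (j+1)`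
  have h := hasSum_sandwich_readout_coDressKBmAt hLc hr hK hδ hV hm α β
    (cL := fun α κ => -(if κ = α then ((((Lc ^ (j + 1 + 1) : ℕ) : ℝ)) ^ (d + 1 + 1))⁻¹ else 0))
    (cR := fun κ' μ => if κ' = μ then ((((Lc ^ (j + 1 + 1) : ℕ) : ℝ)) ^ (d + 1 + 1))⁻¹ else 0)
    (fun t α κ => hasSum_KInvStep_inr_inl (j + 1) α κ t) (fun t α m => hasSum_KInvStep_mm_left (j + 1) α m t)
    (fun u κ' μ => hasSum_KInvStep_inl_inr (j + 1) κ' μ u) (fun u m μ => hasSum_KInvStep_mm_right (j + 1) m μ u)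
  simp only [sum_sum_face_kron] at h
  rw [tsum_neg, tsum_mul_left] at h
  -- the face-restricted pair sum of (α) is its ω-charge for the bounded face weight: INTENT 5 §3
  have hω : ∀ xz : Site (d + 1) × Site (d + 1),
      |(if xz.1 α % (Lc : ℤ) = (Lc : ℤ) - 1 ∧ xz.2 β % (Lc : ℤ) = (Lc : ℤ) - 1 then (1 : ℝ) else 0)| ≤ 1 := fun xz => by
    split_ifs <;> simp
  have hw := hasSum_weighted_rotatedVertex_comb hLc hr cE cVH cΛ j y ν y' (Sum.inl α) (Sum.inl β) hω
  have e : (∑' yw : Site (d + 1) × Site (d + 1),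
      (if yw.1 α % (Lc : ℤ) = (Lc : ℤ) - 1 ∧ yw.2 β % (Lc : ℤ) = (Lc : ℤ) - 1 then
        ((1 / 2 : ℝ) • dM (conjV (coDressKBmAt (toSite r) Lc (KInvStep (d := d) Lc (j + 1)))
            (diagK (((1 : ℝ) / 2) • ∑ v ∈ box (d + 1) Lc, legInd (toSite r) ((Lc : ℤ) • y + toSite v)))) Lc
            (SpureRecAt d Lc (toSite r) cE cVH cΛ (j + 1)) (M1At d Lc (toSite r) cΛ (j + 1)) ν y') yw.1 yw.2 (Sum.inl α) (Sum.inl β) else 0))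
      = _ := (hw.congr_fun fun yw => by rw [boole_mul]).tsum_eq
  rw [e] at h
  exact h

/-! ## §2 The zeroth and first slot-moments of the transported (α)-charge -/

omit [NeZero Lc] in
/-- [folklore] The exit-face weight is `Lc`-PERIODIC (simultaneous block translations do not move residues). -/
theorem faceWeight_periodic (α β : Fin (d + 1)) (s : Site (d + 1)) (xz : Site (d + 1) × Site (d + 1)) :
    (if (xz.1 + (Lc : ℤ) • s) α % (Lc : ℤ) = (Lc : ℤ) - 1 ∧ (xz.2 + (Lc : ℤ) • s) β % (Lc : ℤ) = (Lc : ℤ) - 1 then (1 : ℝ) else 0) =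
      (if xz.1 α % (Lc : ℤ) = (Lc : ℤ) - 1 ∧ xz.2 β % (Lc : ℤ) = (Lc : ℤ) - 1 then (1 : ℝ) else 0) := by
  have e1 : (xz.1 + (Lc : ℤ) • s) α % (Lc : ℤ) = xz.1 α % (Lc : ℤ) := by
    rw [Pi.add_apply, Pi.smul_apply, smul_eq_mul, Int.add_mul_emod_self_left]
  have e2 : (xz.2 + (Lc : ℤ) • s) β % (Lc : ℤ) = xz.2 β % (Lc : ℤ) := by
    rw [Pi.add_apply, Pi.smul_apply, smul_eq_mul, Int.add_mul_emod_self_left]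
  rw [e1, e2]

/-- NOT IN PRINT; OUR BOOKKEEPING.  **THE ZEROTH SLOT-MOMENT OF THE TRANSPORTED (α)-CHARGE VANISHES** (E15 (iii)∕R14 (1): `M0(α) ≈ 3e-12` on the engine — here for the
literal, every level, label, slot direction, channel, in-block root): `HasSum (y′ ↦ [the value of §1 at slot (ν,y′)]) 0` — INTENT 5's `hasSum_totalCharge_weighted_comb` at the
(periodic, bounded) exit-face weight, times `−Lc²σ²`. -/
theorem hasSum_transported_totalCharge_comb (hLc : 1 ≤ Lc) {r : Fin (d + 1) → ℕ} (hr : r ∈ box (d + 1) Lc) (cE cVH cΛ : ℝ) (j : ℕ)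
    (y : Fin (d + 1) → ℤ) (ν : Fin (d + 1)) (α β : Fin (d + 1)) :
    HasSum (fun y' : Site (d + 1) =>
      -((Lc : ℝ) ^ 2 * (((((Lc ^ (j + 1 + 1) : ℕ) : ℝ)) ^ (d + 1 + 1))⁻¹) ^ 2 *
        ((1 / 2 : ℝ) *
          ((∑ κ : Fin (d + 1), ∑' u : Site (d + 1),
              colH (coDressKBmAt (toSite r) Lc (KInvStep (d := d) Lc (j + 1))) Lc ν y' κ u
                * ((if y' = y then (1 / 2 : ℝ) else 0) - (if blk Lc u = y then (1 / 2 : ℝ) else 0))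
                * ∑' xz : Site (d + 1) × Site (d + 1),
                    (if xz.1 α % (Lc : ℤ) = (Lc : ℤ) - 1 ∧ xz.2 β % (Lc : ℤ) = (Lc : ℤ) - 1 then (1 : ℝ) else 0)
                      * SpureRecAt d Lc (toSite r) cE cVH cΛ (j + 1) κ u xz.1 xz.2 (Sum.inl α) (Sum.inl β))
            + ∑ ρ' : Fin (d + 1), ∑' w : Site (d + 1),
              colM (coDressKBmAt (toSite r) Lc (KInvStep (d := d) Lc (j + 1))) Lc ν y' ρ' w
                * ((if y' = y then (1 / 2 : ℝ) else 0) - (if w = y then (1 / 2 : ℝ) else 0))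
                * ∑' xz : Site (d + 1) × Site (d + 1),
                    (if xz.1 α % (Lc : ℤ) = (Lc : ℤ) - 1 ∧ xz.2 β % (Lc : ℤ) = (Lc : ℤ) - 1 then (1 : ℝ) else 0)
                      * M1At d Lc (toSite r) cΛ (j + 1) ρ' w xz.1 xz.2 (Sum.inl α) (Sum.inl β))))) 0 := by
  classical
  have hω : ∀ xz : Site (d + 1) × Site (d + 1),
      |(if xz.1 α % (Lc : ℤ) = (Lc : ℤ) - 1 ∧ xz.2 β % (Lc : ℤ) = (Lc : ℤ) - 1 then (1 : ℝ) else 0)| ≤ 1 := fun xz => by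
    split_ifs <;> simp
  have h := (hasSum_totalCharge_weighted_comb hLc hr cE cVH cΛ j y ν (Sum.inl α) (Sum.inl β) hω
    (fun s xz => faceWeight_periodic α β s xz)).mul_left
    (-((Lc : ℝ) ^ 2 * (((((Lc ^ (j + 1 + 1) : ℕ) : ℝ)) ^ (d + 1 + 1))⁻¹) ^ 2))
  rw [mul_zero] at h
  refine h.congr_fun fun y' => ?_
  ring

/-- NOT IN PRINT; OUR BOOKKEEPING.  **THE SLOT-DIPOLE OF THE TRANSPORTED (α)-CHARGE, CLOSED AND LABEL-FREE**: `Σ_{y′} (y′−y)_λ·[value of §1 at slot (ν,y′)] =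
−Lc²σ²·(−¼)·[Σ_κ Σ_{v∈box} (Σ'_t t_λ·colH G_{j+1} ν t κ v)·Z^{face}_S(κ,v) + Σ_ρ′ (Σ'_t t_λ·colM G_{j+1} ν t ρ′ 0)·Z^{face}_M(ρ′,0)]` with `Z^{face}` the exit-face-weighted channel-`(α,β)`
pair charges of `S_{j+1} κ v` ∕ `M1_{j+1} ρ′ 0` — INTENT 5's `hasSum_slotMoment_weighted_comb` at the exit-face weight.  This is the (α) number in R12's (S) (E15: `|π_λ| = 480.4 ∕ 473.3`,
transverse only), DISPLAYED as a tree term; its cancellation against (γ)'s is the (S)∕(INV) row. -/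
theorem hasSum_transported_slotMoment_comb (hLc : 1 ≤ Lc) {r : Fin (d + 1) → ℕ} (hr : r ∈ box (d + 1) Lc) (cE cVH cΛ : ℝ) (j : ℕ)
    (y : Fin (d + 1) → ℤ) (ν lam : Fin (d + 1)) (α β : Fin (d + 1)) :
    HasSum (fun y' : Site (d + 1) => (((y' lam : ℤ) : ℝ) - ((y lam : ℤ) : ℝ)) *
      -((Lc : ℝ) ^ 2 * (((((Lc ^ (j + 1 + 1) : ℕ) : ℝ)) ^ (d + 1 + 1))⁻¹) ^ 2 *
        ((1 / 2 : ℝ) *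
          ((∑ κ : Fin (d + 1), ∑' u : Site (d + 1),
              colH (coDressKBmAt (toSite r) Lc (KInvStep (d := d) Lc (j + 1))) Lc ν y' κ u
                * ((if y' = y then (1 / 2 : ℝ) else 0) - (if blk Lc u = y then (1 / 2 : ℝ) else 0))
                * ∑' xz : Site (d + 1) × Site (d + 1),
                    (if xz.1 α % (Lc : ℤ) = (Lc : ℤ) - 1 ∧ xz.2 β % (Lc : ℤ) = (Lc : ℤ) - 1 then (1 : ℝ) else 0)
                      * SpureRecAt d Lc (toSite r) cE cVH cΛ (j + 1) κ u xz.1 xz.2 (Sum.inl α) (Sum.inl β))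
            + ∑ ρ' : Fin (d + 1), ∑' w : Site (d + 1),
              colM (coDressKBmAt (toSite r) Lc (KInvStep (d := d) Lc (j + 1))) Lc ν y' ρ' w
                * ((if y' = y then (1 / 2 : ℝ) else 0) - (if w = y then (1 / 2 : ℝ) else 0))
                * ∑' xz : Site (d + 1) × Site (d + 1),
                    (if xz.1 α % (Lc : ℤ) = (Lc : ℤ) - 1 ∧ xz.2 β % (Lc : ℤ) = (Lc : ℤ) - 1 then (1 : ℝ) else 0)
                      * M1At d Lc (toSite r) cΛ (j + 1) ρ' w xz.1 xz.2 (Sum.inl α) (Sum.inl β)))))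
      (-((Lc : ℝ) ^ 2 * (((((Lc ^ (j + 1 + 1) : ℕ) : ℝ)) ^ (d + 1 + 1))⁻¹) ^ 2) *
        (-(1 / 4 : ℝ) *
          ((∑ κ : Fin (d + 1), ∑ v ∈ box (d + 1) Lc,
              (∑' t : Site (d + 1), ((t lam : ℤ) : ℝ) * colH (coDressKBmAt (toSite r) Lc (KInvStep (d := d) Lc (j + 1))) Lc ν t κ (toSite v))
                * ∑' xz : Site (d + 1) × Site (d + 1),
                    (if xz.1 α % (Lc : ℤ) = (Lc : ℤ) - 1 ∧ xz.2 β % (Lc : ℤ) = (Lc : ℤ) - 1 then (1 : ℝ) else 0)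
                      * SpureRecAt d Lc (toSite r) cE cVH cΛ (j + 1) κ (toSite v) xz.1 xz.2 (Sum.inl α) (Sum.inl β))
            + ∑ ρ' : Fin (d + 1),
              (∑' t : Site (d + 1), ((t lam : ℤ) : ℝ) * colM (coDressKBmAt (toSite r) Lc (KInvStep (d := d) Lc (j + 1))) Lc ν t ρ' 0)
                * ∑' xz : Site (d + 1) × Site (d + 1),
                    (if xz.1 α % (Lc : ℤ) = (Lc : ℤ) - 1 ∧ xz.2 β % (Lc : ℤ) = (Lc : ℤ) - 1 then (1 : ℝ) else 0)
                      * M1At d Lc (toSite r) cΛ (j + 1) ρ' 0 xz.1 xz.2 (Sum.inl α) (Sum.inl β)))) := by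
  classical
  have h := (hasSum_slotMoment_weighted_comb hLc hr cE cVH cΛ j y ν lam (Sum.inl α) (Sum.inl β)
    (ω := fun xz : Site (d + 1) × Site (d + 1) => if xz.1 α % (Lc : ℤ) = (Lc : ℤ) - 1 ∧ xz.2 β % (Lc : ℤ) = (Lc : ℤ) - 1 then (1 : ℝ) else 0)
    (fun s xz => faceWeight_periodic α β s xz)).mul_left
    (-((Lc : ℝ) ^ 2 * (((((Lc ^ (j + 1 + 1) : ℕ) : ℝ)) ^ (d + 1 + 1))⁻¹) ^ 2))
  refine h.congr_fun fun y' => ?_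
  ring

end Summit.QuantumFields.BalabanUV.Beta.GAN24.WardResidualRotatedVertexTransported

end
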